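import Mathlib
import Summits.MatrixMultiplication.MatrixMultiplication.Theses.FourierTwoFamiliesModP
import Summits.MatrixMultiplication.MatrixMultiplication.Theorems.PrimeTwoFamilies.Negative.Slices
import Literature.Computability.AlgebraicComplexity.SimultaneousDoubleProduct
import Summits.MatrixMultiplication.MatrixMultiplication.Theorems.FourierTwoFamiliesModPCyclicReductionTransfer
import Summits.MatrixMultiplication.MatrixMultiplication.Theorems.FourierTwoFamiliesModPPrimeTwoFamiliesCapacityLift
import Summits.MatrixMultiplication.MatrixMultiplication.Theorems.FourierTwoFamiliesModPPrimeTwoFamiliesCapacityEquivalences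
import Summits.MatrixMultiplication.MatrixMultiplication.Theorems.FourierTwoFamiliesModPPrimeTwoFamiliesPaleyPatternCapacity
import Summits.MatrixMultiplication.MatrixMultiplication.Theorems.FourierTwoFamiliesModPPrimeTwoFamiliesStubSelfConverse
import Summits.MatrixMultiplication.MatrixMultiplication.Theorems.FourierTwoFamiliesModPPrimeTwoFamiliesStubCapBookkeeping
import Summits.MatrixMultiplication.MatrixMultiplication.Theorems.FourierTwoFamiliesModPPrimeTwoFamiliesStubGadgetsOfCrux
import Summits.MatrixMultiplication.MatrixMultiplication.Theorems.FourierTwoFamiliesModPPrimeTwoFamiliesStubPackingTightOfCrux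
import Summits.MatrixMultiplication.MatrixMultiplication.Theorems.FourierTwoFamiliesModPPrimeTwoFamiliesStubCruxOfPackingTight

/-!
# Line `Sketch` (cycle c1: reshaped to the capacity-gadget form of ideator 6) —
# skeleton for crux `PrimeTwoFamilies` (stmt-MatrixMultiplication-14308)

LEAD COPY (prover-line-stmt-MatrixMultiplication-14308-c3-0; cycle c3-1 RESHAPE along the PATTERN AXIS).
Leads c1/c2 left one open stub, `stub_gadgets` (SelfConverseGadgets), crux-EQUIVALENT by the landed iff
`selfConverseGadgets_iff_primeTwoFamilies` (p99109), and an exhausted finite census (Lines/Sketch-census-c2.md).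
Cycle c3 reshapes that stub into the two registered stubs of strategist s2's pattern-axis split
(Lines/paley_pattern_capacity.lean, STRATEGY-CENSUS gen 3 §D-s2.1), the only decomposition of this crux on record
whose pieces are NOT crux-equivalent by a landed theorem:
  `stub_paleyGadgets`  (7, OPEN; a consequence of the crux) — `q ≥ m^{1/2-ε}` direct pairs in `ℤ/m` of co-volume
                        `≥ m^{1-ε}` whose strong-separation digraph contains the Paley tournament `P_q`, `q ≡ 3 (4)`;
  `stub_paleyCapacity` (8, OPEN both ways in print; the lead's) — the Sperner capacity of the Paley tournaments is
                        full in exponent, `Σ(P_q) ≥ (1-ε) log q` (known: `½ log q ≤ Σ(P_q) ≤ log((q+1)/2)`).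
`stub_gadgets` is now DERIVED (`selfConverseGadgets_of_paley` = LANDED glue `PaleyPatternCapacity.PrimeTwoFamilies_of_paley`
(p168221, ≈ 80 lines, the strategist's candidate `PaleyPatternCapacityHelper.lean` verbatim) followed by `stub_gadgetsOfCrux`); the composition `PrimeTwoFamilies_of` is unchanged.  Registered stubs after the
reshape: 1, 2, 4, 5, 6 (CLOSED), 7, 8 (OPEN) — seven `stub_` declarations, sorries only in 7 and 8.
Lead c3's own computations on stub 8 (folder calc/, kit j026818-20): the Delsarte/Schrijver LP of the translation
scheme ({0}, squares, non-squares)^L is USELESS as a capacity bound (LP(7,L)^{1/L} = 4.006 at L = 13 > (q+1)/2 and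
rising) but pins the FIXED-LENGTH exponents: LP(q,3) ≈ 3q, LP(q,4) → 1.79 q², LP(q,6) ≈ 8 q³ (q ≤ 251), i.e.
max Paley–Sperner codes of fixed length L have size Θ(q^{⌊L/2⌋})-ish = the product construction's exponent;
tr(P_7^2) = 9 = tr(P_7)² (no superadditivity at t = 2).  Previous header (c1) follows.

LEAD COPY (prover-line-stmt-MatrixMultiplication-14308-c1-0).  Supersedes in place the round-1 skeleton of
this line (LadderLift: `stub_lift` p85800, `stub_words` p85818, `stub_bookkeeping` p86211 landed, equivalence
`Theorems.PrimeTwoFamilies.LadderLift.primeTwoFamilies_iff_cyclicLadder` p91570 landed; its open stub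
`stub_cyclicLadder` ≡ crux).  The reshape replaces the transitive (ladder) code by a general ZERO-ERROR CODE
over a redundant alphabet of direct pairs (idea `zero-error-capacity-gadgets`, `SketchIdeatorSix.lean`):
`codeLift` (proved) generalises `stub_lift`, and the open stub becomes the gadget statement.

Crux (route `FourierTwoFamiliesModP`, rank 0, CKSU 2005 Conj. 4.7 with prime cyclic hosts):
`∀ δ > 0 ∀ n₀ ∃ n ≥ n₀ ∃ p prime ∃ (A B : Fin n → Finset (ZMod p)), (W) ∧ (X) ∧ p ≤ n^{2+δ} ∧
∀ i, n^{2-δ} ≤ |A i| |B i|`.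

## The line
A GADGET is a list of direct pairs `(P σ, Q σ)_{σ<r}` in `ℤ/m` (letters may overlap or coincide).  Letter
`σ` is STRONGLY SEPARATED towards `τ` if `Q τ - P σ` avoids `D = ⋃_c (Q c - P c)`.  A set of words
`W ⊆ (Fin L → Fin r)` in which every ordered pair of distinct words is strongly separated in some coordinate
(a zero-error code) lifts to an SDPP family of `|W|` blocks in `Fin L → ℤ/m` (`codeLift`, PROVED); the
tree's carry-free transfer `Theorems.exists_prime_sdpp_of_addEquiv` (route support CyclicReduction) moves it
into a Bertrand prime `p ≤ 2·3^L·m^L` with sizes kept, and the exponent bookkeeping `stub_capBookkeeping`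
(uniform in `L`) closes every slice `0 < δ ≤ 1` from `CapacityGadgets` (codes of size `≥ (m^L)^{1/2-ε}` over
letters of co-volume `≥ m^{1-ε}`, arbitrarily large `m`).  The L = 2 form `SelfConverseGadgets` (one map `π`
separating every ordered pair directly or after `π`; graph words `(σ, π σ)`) implies `CapacityGadgets`
(`stub_selfConverse`) and is the registered OPEN stub `stub_gadgets` (the lead's).

HONEST STATUS of the open stub (lead's check, cycle c1): `SelfConverseGadgets` is IMPLIED by the crux —
repeat the `n` letters of an honest slice-δ witness `n` times, `π (i,j) := (j,j)` (`stub_gadgetsOfCrux`,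
registered) — so `SelfConverseGadgets ⟺ CapacityGadgets ⟺ PrimeTwoFamilies` (`selfConverseGadgets_iff`,
`capacityGadgets_iff` below, kernel-checked modulo the provable stubs): the open stub is crux-sized BY
THEOREM, exactly as in round 1; what the reshape adds is the code/transfer machinery and a different search
space (redundant alphabets, census F2 of the card), not a strictly stronger finitary target.

## Kill-side calibration adopted from `PaddingSketch` (crux-plan ladder-zone-frame-cap, no-skeleton finding)
§K registers the two bookkeeping theorems of PaddingSketch.lean as stubs: `stub_packingTightOfCrux` (crux ⟹
packing-tight SDPP families at EVERY co-volume scale `γ ∈ (0,1)`: pad a slice witness by the singleton design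
of `ℤ/M` and transfer with `k = 2` cyclic factors) and `stub_cruxOfPackingTight` (converse, `γ = 1 - δ/8`);
corollaries `primeTwoFamilies_iff_packingTight` and the SINGLE-SCALE KILL CRITERION
`primeTwoFamilies_false_of_singleScaleDefect` (a power defect at any one scale refutes the crux; generalises
Disproof §3c / PowerGainRefutes).

## Registered stubs (≤ 7)
1. `stub_selfConverse`        — SelfConverseGadgets → CapacityGadgets (graph words are a code).  CLOSED p96848.
2. `stub_capBookkeeping`      — real-exponent bookkeeping, `ε = δ/8`, uniform in `L ≥ 1`.  CLOSED p97144.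
3. (`stub_gadgets`, c1/c2)   — SelfConverseGadgets; ≡ crux (p99109).  RESHAPED c3: derived as `selfConverseGadgets_of_paley` from 7 ∧ 8.
4. `stub_gadgetsOfCrux`       — PrimeTwoFamilies → SelfConverseGadgets (letter repetition).  CLOSED p96841.
5. `stub_packingTightOfCrux`  — PrimeTwoFamilies → PackingTightAt γ for all γ ∈ (0,1) (padding + transfer).  CLOSED p97411.
6. `stub_cruxOfPackingTight`  — (∀ γ ∈ (0,1), PackingTightAt γ) → every slice.  CLOSED p96975.
7. `stub_paleyGadgets`        — Paley-pattern gadgets at the apex scale (pattern ⊇ P_q on q ≥ m^{1/2-ε} letters).  OPEN.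
8. `stub_paleyCapacity`       — Σ(P_q) ≥ (1-ε) log q for all large primes q ≡ 3 (4).  OPEN; the lead's (c3).
All six are stated over Mathlib primitives + tree decls only (gadget/packing notions inlined); wave 1 (5 workers,
2026-08-16) landed 1, 2, 4, 5, 6 verbatim as `--supports` helpers in namespace
`Summit.MatrixMultiplication.MatrixMultiplication.Theorems.PrimeTwoFamilies.CapacityLift` (+ `codeLift`,
`selfConverseLift`: p96487); the skeleton now delegates to them.  Open after the c3 reshape: 7, 8 (3 derived).

Disproof used (Cruxes/PrimeTwoFamilies/Disproof.lean v2, re-read 2026-08-16T10:30Z): no `_false_without_`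
theorem and no `-- Targets` section exist for this ∃-crux; §6 — the code lift keeps all four clauses verbatim;
§2/§2b shape diversity — lifted blocks over one Q-template are one template, so letters must be pairwise
non-translate (design rule for stub 3; it is also WHY the pentagon family `({u},{u,u+1})` cannot leave the wall);
§1/§5 translates = the line θ + γ = 1; §3/§3c conditional kills untouched (a gadget family at the apex refutes
PrimeCyclicPowerGain); §K's criterion generalises §3c to one scale.
-/

-- single-conjunct summit: the mandated namespace repeats `MatrixMultiplication`.
set_option linter.dupNamespace false

namespace Summit.MatrixMultiplication.MatrixMultiplication.Cruxes.PrimeTwoFamilies.CapacityLift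

open Finset
open Summit.MatrixMultiplication.MatrixMultiplication.Theses
open Summit.MatrixMultiplication.MatrixMultiplication.Theorems
open Summit.MatrixMultiplication.MatrixMultiplication.Theorems.PrimeTwoFamilies.Negative
open Literature.Computability.AlgebraicComplexity

/-! ## Objects -/

/-- Every letter `(P c, Q c)` is a DIRECT pair (clause (W) letterwise). -/
def Direct {K : Type*} [AddCommGroup K] {r : ℕ} (P Q : Fin r → Finset K) : Prop :=
  ∀ c : Fin r, ∀ x ∈ P c, ∀ x' ∈ P c, ∀ y ∈ Q c, ∀ y' ∈ Q c,
    (x - x') + (y - y') = 0 → x = x' ∧ y = y'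

/-- STRONG SEPARATION of letter `σ` towards letter `τ`: the cross difference set `Q τ − P σ` avoids every
diagonal difference set `Q c − P c`. -/
def StrongSep {K : Type*} [AddCommGroup K] {r : ℕ} (P Q : Fin r → Finset K) (σ τ : Fin r) : Prop :=
  ∀ p ∈ P σ, ∀ q ∈ Q τ, ∀ c : Fin r, ∀ p' ∈ P c, ∀ q' ∈ Q c, q - p ≠ q' - p'

/-- A ZERO-ERROR CODE over the gadget: every ordered pair of distinct words is strongly separated in at least
one coordinate. -/
def IsZeroErrorCode {K : Type*} [AddCommGroup K] {r L : ℕ} (P Q : Fin r → Finset K)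
    (W : Finset (Fin L → Fin r)) : Prop :=
  ∀ i ∈ W, ∀ k ∈ W, i ≠ k → ∃ t : Fin L, StrongSep P Q (i t) (k t)

/-- **CAPACITY GADGETS** (transfer target C⁺, general code form): for every `ε > 0` there are arbitrarily
large `m`, a gadget of direct pairs in `ℤ/m` with all co-volumes `≥ m^{1-ε}`, and a zero-error code `W` of
length `L ≥ 1` over it with `|W| ≥ (m^L)^{1/2-ε}`. -/
def CapacityGadgets : Prop :=
  ∀ ε : ℝ, 0 < ε → ∀ m₀ : ℕ, ∃ m ≥ m₀, ∃ r L : ℕ, ∃ P Q : Fin r → Finset (ZMod m),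
    ∃ W : Finset (Fin L → Fin r),
      Direct P Q ∧ IsZeroErrorCode P Q W ∧ 1 ≤ L ∧
      ((m : ℝ) ^ (L : ℝ)) ^ (1 / 2 - ε) ≤ (W.card : ℝ) ∧
      ∀ c : Fin r, (m : ℝ) ^ (1 - ε) ≤ (((P c).card * (Q c).card : ℕ) : ℝ)

/-- **SELF-CONVERSE GADGETS** (L = 2 form): arbitrarily large `m`, `r ≥ m^{1-ε}` direct pairs in `ℤ/m` of
co-volume `≥ m^{1-ε}`, and a map `π` under which every ordered pair of distinct letters is strongly separated
directly or after `π`. -/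
def SelfConverseGadgets : Prop :=
  ∀ ε : ℝ, 0 < ε → ∀ m₀ : ℕ, ∃ m ≥ m₀, ∃ r : ℕ, ∃ P Q : Fin r → Finset (ZMod m), ∃ π : Fin r → Fin r,
    Direct P Q ∧ (∀ σ τ : Fin r, σ ≠ τ → StrongSep P Q σ τ ∨ StrongSep P Q (π σ) (π τ)) ∧
    (m : ℝ) ^ (1 - ε) ≤ (r : ℝ) ∧
    ∀ c : Fin r, (m : ℝ) ^ (1 - ε) ≤ (((P c).card * (Q c).card : ℕ) : ℝ)

/-- **PACKING-TIGHT AT SCALE `γ`**: for every `ε > 0`, arbitrarily large primes `p` carry an SDPP family with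
all co-volumes `≥ p^γ` and `n ≥ p^{1-γ/2-ε}` pairs (the packing bound `n ≤ p^{1-γ/2}` met in exponent). -/
def PackingTightAt (γ : ℝ) : Prop :=
  ∀ ε : ℝ, 0 < ε → ∀ p₀ : ℕ, ∃ p ≥ p₀, p.Prime ∧ ∃ (n : ℕ) (A B : Fin n → Finset (ZMod p)),
    (∀ i : Fin n, ∀ a ∈ A i, ∀ a' ∈ A i, ∀ b ∈ B i, ∀ b' ∈ B i,
        (a - a') + (b - b') = 0 → a = a' ∧ b = b') ∧
    (∀ i j k : Fin n, ∀ a ∈ A i, ∀ a' ∈ A j, ∀ b ∈ B j, ∀ b' ∈ B k,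
        (a - a') + (b - b') = 0 → i = k) ∧
    (∀ i : Fin n, (p : ℝ) ^ γ ≤ (((A i).card * (B i).card : ℕ) : ℝ)) ∧
    (p : ℝ) ^ (1 - γ / 2 - ε) ≤ (n : ℝ)

/-- **SINGLE-SCALE DEFECT `c` AT SCALE `γ`**: for all large primes `p`, every SDPP family in `ℤ/p` with all
co-volumes `≥ p^γ` has `n ≤ p^{1-γ/2-c}` pairs. -/
def SingleScaleDefect (γ c : ℝ) : Prop :=
  ∃ p₀ : ℕ, ∀ p : ℕ, p.Prime → p₀ ≤ p → ∀ (n : ℕ) (A B : Fin n → Finset (ZMod p)),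
    (∀ i : Fin n, ∀ a ∈ A i, ∀ a' ∈ A i, ∀ b ∈ B i, ∀ b' ∈ B i,
        (a - a') + (b - b') = 0 → a = a' ∧ b = b') →
    (∀ i j k : Fin n, ∀ a ∈ A i, ∀ a' ∈ A j, ∀ b ∈ B j, ∀ b' ∈ B k,
        (a - a') + (b - b') = 0 → i = k) →
    (∀ i : Fin n, (p : ℝ) ^ γ ≤ (((A i).card * (B i).card : ℕ) : ℝ)) →
    (n : ℝ) ≤ (p : ℝ) ^ (1 - γ / 2 - c)

/-! ## The code lift (PROVED; ideator 6) -/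

/-- **CODE LIFT.**  A zero-error code over a gadget of direct pairs lifts to an SDPP family in `Fin L → K`:
blocks `A w = ∏ₜ P (w t)`, `B w = ∏ₜ Q (w t)` for `w ∈ W`, clauses (W), (X) verbatim as in the route. -/
theorem codeLift {K : Type*} [AddCommGroup K] [DecidableEq K] {r L : ℕ}
    (P Q : Fin r → Finset K) (hD : Direct P Q)
    (W : Finset (Fin L → Fin r)) (hW : IsZeroErrorCode P Q W) :
    (∀ w ∈ W, ∀ a ∈ Fintype.piFinset (fun t => P (w t)), ∀ a' ∈ Fintype.piFinset (fun t => P (w t)),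
      ∀ b ∈ Fintype.piFinset (fun t => Q (w t)), ∀ b' ∈ Fintype.piFinset (fun t => Q (w t)),
        (a - a') + (b - b') = 0 → a = a' ∧ b = b') ∧
    (∀ i ∈ W, ∀ j ∈ W, ∀ k ∈ W,
      ∀ a ∈ Fintype.piFinset (fun t => P (i t)), ∀ a' ∈ Fintype.piFinset (fun t => P (j t)),
      ∀ b ∈ Fintype.piFinset (fun t => Q (j t)), ∀ b' ∈ Fintype.piFinset (fun t => Q (k t)),
        (a - a') + (b - b') = 0 → i = k) := by
  refine ⟨?_, ?_⟩
  · intro w _ a ha a' ha' b hb b' hb' h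
    rw [Fintype.mem_piFinset] at ha ha' hb hb'
    have key : ∀ t, a t = a' t ∧ b t = b' t := fun t =>
      hD (w t) (a t) (ha t) (a' t) (ha' t) (b t) (hb t) (b' t) (hb' t)
        (by have := congrFun h t; simpa using this)
    exact ⟨funext fun t => (key t).1, funext fun t => (key t).2⟩
  · intro i hi j _ k hk a ha a' ha' b hb b' hb' h
    rw [Fintype.mem_piFinset] at ha ha' hb hb'
    by_contra hik
    obtain ⟨t, ht⟩ := hW i hi k hk hik
    have key : (a t - a' t) + (b t - b' t) = 0 := by
      have := congrFun h t; simpa using this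
    have e : b' t - a t = b t - a' t := by
      have h2 : (a t - a' t) + (b t - b' t) = (b t - a' t) - (b' t - a t) := by abel
      rw [h2] at key
      exact (sub_eq_zero.1 key).symm
    exact ht (a t) (ha t) (b' t) (hb' t) (j t) (a' t) (ha' t) (b t) (hb t) e

/-! ## Registered stubs

All stubs are stated over Mathlib primitives and tree declarations only (the gadget and packing notions are
inlined), so that each lands verbatim as a `--supports` helper file. -/

/-- STUB 1 (S): the L = 2 self-converse form implies the general capacity form — the `r` graph words
`![σ, π σ] : Fin 2 → Fin r` are a zero-error code of size `r ≥ m^{1-ε} ≥ (m^2)^{1/2-ε}`. -/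
theorem stub_selfConverse
    (h : ∀ ε : ℝ, 0 < ε → ∀ m₀ : ℕ, ∃ m ≥ m₀, ∃ r : ℕ, ∃ P Q : Fin r → Finset (ZMod m),
      ∃ π : Fin r → Fin r,
      (∀ c : Fin r, ∀ x ∈ P c, ∀ x' ∈ P c, ∀ y ∈ Q c, ∀ y' ∈ Q c,
          (x - x') + (y - y') = 0 → x = x' ∧ y = y') ∧
      (∀ σ τ : Fin r, σ ≠ τ →
        (∀ p ∈ P σ, ∀ q ∈ Q τ, ∀ c : Fin r, ∀ p' ∈ P c, ∀ q' ∈ Q c, q - p ≠ q' - p') ∨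
        (∀ p ∈ P (π σ), ∀ q ∈ Q (π τ), ∀ c : Fin r, ∀ p' ∈ P c, ∀ q' ∈ Q c, q - p ≠ q' - p')) ∧
      (m : ℝ) ^ (1 - ε) ≤ (r : ℝ) ∧
      ∀ c : Fin r, (m : ℝ) ^ (1 - ε) ≤ (((P c).card * (Q c).card : ℕ) : ℝ)) :
    ∀ ε : ℝ, 0 < ε → ∀ m₀ : ℕ, ∃ m ≥ m₀, ∃ r L : ℕ, ∃ P Q : Fin r → Finset (ZMod m),
      ∃ W : Finset (Fin L → Fin r),
      (∀ c : Fin r, ∀ x ∈ P c, ∀ x' ∈ P c, ∀ y ∈ Q c, ∀ y' ∈ Q c,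
          (x - x') + (y - y') = 0 → x = x' ∧ y = y') ∧
      (∀ i ∈ W, ∀ k ∈ W, i ≠ k → ∃ t : Fin L,
        ∀ p ∈ P (i t), ∀ q ∈ Q (k t), ∀ c : Fin r, ∀ p' ∈ P c, ∀ q' ∈ Q c, q - p ≠ q' - p') ∧
      1 ≤ L ∧
      ((m : ℝ) ^ (L : ℝ)) ^ (1 / 2 - ε) ≤ (W.card : ℝ) ∧
      ∀ c : Fin r, (m : ℝ) ^ (1 - ε) ≤ (((P c).card * (Q c).card : ℕ) : ℝ) :=
  -- CLOSED: landed p96848 (Theorems/FourierTwoFamiliesModPPrimeTwoFamiliesStubSelfConverse.lean)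
  Theorems.PrimeTwoFamilies.CapacityLift.stub_selfConverse h

/-- STUB 2 (M): exponent bookkeeping for the capacity transfer, uniform in the word length `L ≥ 1`: for
`0 < δ ≤ 1` fix `ε > 0` (e.g. `δ/8`); for every `n₀` there is `m₀` such that for `m ≥ m₀`, any `L ≥ 1`, any
code size `N ≥ (m^L)^{1/2-ε}` and any host `p ≤ 2·3^L·m^L` there is a number `n` of pairs to keep with
`n₀ ≤ n ≤ N`, `p ≤ n^{2+δ}` and `n^{2-δ} ≤ (m^{1-ε})^L` (e.g. `n = max n₀ ⌈p^{1/(2+δ)}⌉₊`,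
`m₀ = max (n₀+1)^4 ⌈24^{8/δ}⌉₊`). -/
theorem stub_capBookkeeping (δ : ℝ) (hδ : 0 < δ) (hδ1 : δ ≤ 1) :
    ∃ ε : ℝ, 0 < ε ∧ ∀ n₀ : ℕ, ∃ m₀ : ℕ, ∀ m : ℕ, m₀ ≤ m → ∀ L : ℕ, 1 ≤ L →
      ∀ N : ℕ, ((m : ℝ) ^ (L : ℝ)) ^ (1 / 2 - ε) ≤ (N : ℝ) →
      ∀ p : ℕ, p ≤ 2 * (3 ^ L * m ^ L) →
        ∃ n : ℕ, n₀ ≤ n ∧ n ≤ N ∧ (p : ℝ) ≤ (n : ℝ) ^ (2 + δ) ∧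
          (n : ℝ) ^ (2 - δ) ≤ ((m : ℝ) ^ (1 - ε)) ^ L :=
  -- CLOSED: landed p97144 (Theorems/FourierTwoFamiliesModPPrimeTwoFamiliesStubCapBookkeeping.lean)
  Theorems.PrimeTwoFamilies.CapacityLift.stub_capBookkeeping δ hδ hδ1

/-! ### Cycle c3 reshape: the pattern-axis stubs (7, 8), the glue, and the derived former stub 3 -/

/-- STUB 7 (OPEN; a consequence of the crux, strictly weaker in known consequence; strategist s2's
`stub_paleyGadgets` verbatim): **PALEY-PATTERN GADGETS** — for every `ε > 0` and every `m₀` there are `m ≥ m₀`, a prime `q ≡ 3 (mod 4)` with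
`m^{1/2-ε} ≤ q`, and `q` DIRECT pairs `(P σ, Q σ)_{σ : Fin q}` in `ZMod m` of co-volume `≥ m^{1-ε}` such that
`σ` is strongly separated towards `τ` (the cross set `Q τ − P σ` avoids every diagonal set `Q c − P c`)
whenever `τ − σ` is a square in `ZMod q` (`σ ≠ τ`).  Since `−1` is a non-square, every pair of distinct
letters is separated in at least one direction. -/
theorem stub_paleyGadgets :
    ∀ ε : ℝ, 0 < ε → ∀ m₀ : ℕ, ∃ m ≥ m₀, ∃ q : ℕ, q.Prime ∧ q % 4 = 3 ∧
      (m : ℝ) ^ (1 / 2 - ε) ≤ (q : ℝ) ∧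
      ∃ P Q : Fin q → Finset (ZMod m),
      (∀ c : Fin q, ∀ x ∈ P c, ∀ x' ∈ P c, ∀ y ∈ Q c, ∀ y' ∈ Q c,
          (x - x') + (y - y') = 0 → x = x' ∧ y = y') ∧
      (∀ σ τ : Fin q, σ ≠ τ → IsSquare (((τ : ℕ) : ZMod q) - ((σ : ℕ) : ZMod q)) →
        ∀ p ∈ P σ, ∀ y ∈ Q τ, ∀ c : Fin q, ∀ p' ∈ P c, ∀ y' ∈ Q c, y - p ≠ y' - p') ∧
      ∀ c : Fin q, (m : ℝ) ^ (1 - ε) ≤ (((P c).card * (Q c).card : ℕ) : ℝ) := by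
  sorry

/-- STUB 8 (OPEN both ways in print — the lead's (c3); strategist s2's `stub_paleyCapacity` verbatim): **PALEY
SPERNER CAPACITY, FULL IN EXPONENT** — for every `ε > 0` and all large primes `q ≡ 3 (mod 4)` there are a word length `L ≥ 1` and a
set `W` of words `Fin L → Fin q` with `|W| ≥ q^{(1-ε)L}` in which every ordered pair of distinct words
`(u, w)` has a coordinate `t` with `u t ≠ w t` and `w t − u t` a square in `ZMod q`. -/
theorem stub_paleyCapacity :
    ∀ ε : ℝ, 0 < ε → ∃ q₀ : ℕ, ∀ q : ℕ, q₀ ≤ q → q.Prime → q % 4 = 3 →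
      ∃ L : ℕ, 1 ≤ L ∧ ∃ W : Finset (Fin L → Fin q),
        (q : ℝ) ^ ((1 - ε) * L) ≤ (W.card : ℝ) ∧
        ∀ u ∈ W, ∀ w ∈ W, u ≠ w →
          ∃ t : Fin L, u t ≠ w t ∧ IsSquare (((w t : ℕ) : ZMod q) - ((u t : ℕ) : ZMod q)) := by
  sorry

/-! The glue `PrimeTwoFamilies_of_paley : stub 7 → stub 8 → PrimeTwoFamilies` (≈ 80 lines of exponent bookkeeping
+ the landed iff `capacityGadgets_iff_primeTwoFamilies`) is LANDED: p168221,
`Theorems/FourierTwoFamiliesModPPrimeTwoFamiliesPaleyPatternCapacity.lean`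
(`Theorems.PrimeTwoFamilies.PaleyPatternCapacity.PrimeTwoFamilies_of_paley`, registered stub of that name). -/

/-- (Former STUB 3, the c1/c2 open stub; ≡ crux by stubs 1, 4 and the composition.)  RESHAPED in cycle c3:
SELF-CONVERSE GADGETS are DERIVED from the Paley stubs 7 ∧ 8 — landed glue `PrimeTwoFamilies_of_paley` (p168221), then letter
repetition `stub_gadgetsOfCrux`. -/
theorem selfConverseGadgets_of_paley :
    ∀ ε : ℝ, 0 < ε → ∀ m₀ : ℕ, ∃ m ≥ m₀, ∃ r : ℕ, ∃ P Q : Fin r → Finset (ZMod m),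
      ∃ π : Fin r → Fin r,
      (∀ c : Fin r, ∀ x ∈ P c, ∀ x' ∈ P c, ∀ y ∈ Q c, ∀ y' ∈ Q c,
          (x - x') + (y - y') = 0 → x = x' ∧ y = y') ∧
      (∀ σ τ : Fin r, σ ≠ τ →
        (∀ p ∈ P σ, ∀ q ∈ Q τ, ∀ c : Fin r, ∀ p' ∈ P c, ∀ q' ∈ Q c, q - p ≠ q' - p') ∨
        (∀ p ∈ P (π σ), ∀ q ∈ Q (π τ), ∀ c : Fin r, ∀ p' ∈ P c, ∀ q' ∈ Q c, q - p ≠ q' - p')) ∧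
      (m : ℝ) ^ (1 - ε) ≤ (r : ℝ) ∧
      ∀ c : Fin r, (m : ℝ) ^ (1 - ε) ≤ (((P c).card * (Q c).card : ℕ) : ℝ) :=
  Theorems.PrimeTwoFamilies.CapacityLift.stub_gadgetsOfCrux
    (Theorems.PrimeTwoFamilies.PaleyPatternCapacity.PrimeTwoFamilies_of_paley
      stub_paleyGadgets stub_paleyCapacity)

/-- STUB 4 (S/M): the crux gives self-converse gadgets — repeat the `n` letters `(A i, B i)` of an honest
slice-`δ` witness (`δ = min ε 1`) `n` times: letter `c : Fin (n*n)` is `(A (e c).1, B (e c).1)` with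
`e = finProdFinEquiv.symm`, and `π c := finProdFinEquiv ((e c).2, (e c).2)`; pairs with different first index
are separated directly by (X), pairs with equal first index differ in the second index and are separated
after `π`; `r = n² ≥ p^{1-ε}`, co-volume `≥ n^{2-δ} ≥ p^{1-ε}`, `m = p ≥ n^{2-δ} ≥ m₀` by
`card_mul_card_le_of_dpp`. -/
theorem stub_gadgetsOfCrux (hT : FourierTwoFamiliesModP.PrimeTwoFamilies) :
    ∀ ε : ℝ, 0 < ε → ∀ m₀ : ℕ, ∃ m ≥ m₀, ∃ r : ℕ, ∃ P Q : Fin r → Finset (ZMod m),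
      ∃ π : Fin r → Fin r,
      (∀ c : Fin r, ∀ x ∈ P c, ∀ x' ∈ P c, ∀ y ∈ Q c, ∀ y' ∈ Q c,
          (x - x') + (y - y') = 0 → x = x' ∧ y = y') ∧
      (∀ σ τ : Fin r, σ ≠ τ →
        (∀ p ∈ P σ, ∀ q ∈ Q τ, ∀ c : Fin r, ∀ p' ∈ P c, ∀ q' ∈ Q c, q - p ≠ q' - p') ∨
        (∀ p ∈ P (π σ), ∀ q ∈ Q (π τ), ∀ c : Fin r, ∀ p' ∈ P c, ∀ q' ∈ Q c, q - p ≠ q' - p')) ∧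
      (m : ℝ) ^ (1 - ε) ≤ (r : ℝ) ∧
      ∀ c : Fin r, (m : ℝ) ^ (1 - ε) ≤ (((P c).card * (Q c).card : ℕ) : ℝ) :=
  -- CLOSED: landed p96841 (Theorems/FourierTwoFamiliesModPPrimeTwoFamiliesStubGadgetsOfCrux.lean)
  Theorems.PrimeTwoFamilies.CapacityLift.stub_gadgetsOfCrux hT

/-- STUB 5 (M, kill side): the crux forces PACKING-TIGHTNESS AT EVERY SCALE `γ ∈ (0,1)`.  Pad a slice-`δ`
witness `(A i, B i)_{i<n₁}` in `ℤ/p₁` (`δ = min (ε/3) …`) by the singleton design of `ℤ/M`,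
`M = ⌊n₁^{(2-δ)/γ}/(18 p₁)⌋₊`: classes `c : Fin (n₁ M)`, `A' c = A c.divNat ×ˢ {↑↑c.modNat}`, `B' c` likewise,
in `ZMod p₁ × ZMod M` — still (W), (X), same co-volumes, `n₁ M` classes; transfer with the tree's
`exists_prime_sdpp_of_addEquiv` (`k = 2`, `e = (RingEquiv.piFinTwo _).symm.toAddEquiv`, prime
`p ≤ 18 p₁ M ≤ n₁^{(2-δ)/γ}`), so `p^γ ≤ n₁^{2-δ} ≤` co-volume and `n₁ M ≥ p^{1-γ/2-ε}`; `p ≥` co-volume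
`≥ n₁ ≥ p₀` by `card_mul_card_le_of_dpp`. -/
theorem stub_packingTightOfCrux (hT : FourierTwoFamiliesModP.PrimeTwoFamilies)
    {γ : ℝ} (hγ : 0 < γ) (hγ1 : γ < 1) :
    ∀ ε : ℝ, 0 < ε → ∀ p₀ : ℕ, ∃ p ≥ p₀, p.Prime ∧ ∃ (n : ℕ) (A B : Fin n → Finset (ZMod p)),
      (∀ i : Fin n, ∀ a ∈ A i, ∀ a' ∈ A i, ∀ b ∈ B i, ∀ b' ∈ B i,
          (a - a') + (b - b') = 0 → a = a' ∧ b = b') ∧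
      (∀ i j k : Fin n, ∀ a ∈ A i, ∀ a' ∈ A j, ∀ b ∈ B j, ∀ b' ∈ B k,
          (a - a') + (b - b') = 0 → i = k) ∧
      (∀ i : Fin n, (p : ℝ) ^ γ ≤ (((A i).card * (B i).card : ℕ) : ℝ)) ∧
      (p : ℝ) ^ (1 - γ / 2 - ε) ≤ (n : ℝ) :=
  -- CLOSED: landed p97411 (Theorems/FourierTwoFamiliesModPPrimeTwoFamiliesStubPackingTightOfCrux.lean)
  Theorems.PrimeTwoFamilies.CapacityLift.stub_packingTightOfCrux hT hγ hγ1

/-- STUB 6 (S, kill side converse): packing-tightness at every scale gives every slice of the crux — for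
`0 < δ ≤ 1` take `γ = 1 - δ/8`, `ε = δ/16` (so `n ≥ p^{1/2}`, i.e. `p ≤ n²`) and keep the first `⌈√p⌉₊`
pairs (`⌈√p⌉₊^{2-δ} ≤ p^{1-δ/8}` for large `p`); slices `δ > 1` by `PrimeTwoFamiliesAt.mono`. -/
theorem stub_cruxOfPackingTight
    (h : ∀ γ : ℝ, 0 < γ → γ < 1 →
      ∀ ε : ℝ, 0 < ε → ∀ p₀ : ℕ, ∃ p ≥ p₀, p.Prime ∧ ∃ (n : ℕ) (A B : Fin n → Finset (ZMod p)),
        (∀ i : Fin n, ∀ a ∈ A i, ∀ a' ∈ A i, ∀ b ∈ B i, ∀ b' ∈ B i,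
            (a - a') + (b - b') = 0 → a = a' ∧ b = b') ∧
        (∀ i j k : Fin n, ∀ a ∈ A i, ∀ a' ∈ A j, ∀ b ∈ B j, ∀ b' ∈ B k,
            (a - a') + (b - b') = 0 → i = k) ∧
        (∀ i : Fin n, (p : ℝ) ^ γ ≤ (((A i).card * (B i).card : ℕ) : ℝ)) ∧
        (p : ℝ) ^ (1 - γ / 2 - ε) ≤ (n : ℝ)) :
    ∀ δ : ℝ, 0 < δ → PrimeTwoFamiliesAt δ :=
  -- CLOSED: landed p96975 (Theorems/FourierTwoFamiliesModPPrimeTwoFamiliesStubCruxOfPackingTight.lean)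
  Theorems.PrimeTwoFamilies.CapacityLift.stub_cruxOfPackingTight h

/-! ## Composition (kernel-checked, no sorry of its own) -/

set_option linter.defProp false in
/-- The glue (a `def` on purpose: the skeleton audit takes THE theorem concluding the crux to be the unique
`theorem` with that conclusion): capacity gadgets give every slice `0 < δ ≤ 1` of the crux.  Choose `ε` by
stub 2; take a gadget level `m ≥ max m₀ 1` with its code `W`; lift (`codeLift`) and enumerate `W` by `Fin N`;
move into `ℤ/p` by the tree's carry-free transfer `exists_prime_sdpp_of_addEquiv` (`k = L` factors `ℤ/m`);
keep the first `n` pairs (stub 2's `n`). -/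
def primeTwoFamiliesAt_of_capacity (hC : CapacityGadgets) {δ : ℝ} (hδ : 0 < δ) (hδ1 : δ ≤ 1) :
    PrimeTwoFamiliesAt δ := by
  classical
  intro n₀
  obtain ⟨ε, hε, hbook⟩ := stub_capBookkeeping δ hδ hδ1
  obtain ⟨m₀, hm₀⟩ := hbook n₀
  obtain ⟨m, hm, r, L, P, Q, W, hD, hCode, hL, hWcard, hcov⟩ := hC ε hε (max m₀ 1)
  have hm₀m : m₀ ≤ m := le_trans (le_max_left _ _) hm
  have hm1 : 1 ≤ m := le_trans (le_max_right _ _) hm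
  set N : ℕ := W.card with hN
  let e : W ≃ Fin N := W.equivFin
  -- the lifted family, indexed by `Fin N`
  let A : Fin N → Finset (Fin L → ZMod m) :=
    fun i => Fintype.piFinset (fun t => P ((e.symm i : Fin L → Fin r) t))
  let B : Fin N → Finset (Fin L → ZMod m) :=
    fun i => Fintype.piFinset (fun t => Q ((e.symm i : Fin L → Fin r) t))
  obtain ⟨hW1, hX1⟩ := codeLift P Q hD W hCode
  have hWA : ∀ i : Fin N, ∀ a ∈ A i, ∀ a' ∈ A i, ∀ b ∈ B i, ∀ b' ∈ B i,
      (a - a') + (b - b') = 0 → a = a' ∧ b = b' :=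
    fun i => hW1 _ (e.symm i).2
  have hXA : ∀ i j k : Fin N, ∀ a ∈ A i, ∀ a' ∈ A j, ∀ b ∈ B j, ∀ b' ∈ B k,
      (a - a') + (b - b') = 0 → i = k := by
    intro i j k a ha a' ha' b hb b' hb' h0
    have hik := hX1 _ (e.symm i).2 _ (e.symm j).2 _ (e.symm k).2 a ha a' ha' b hb b' hb' h0
    exact e.symm.injective (Subtype.ext hik)
  -- transfer into a prime cyclic host (tree: route support CyclicReduction, transfer step)
  obtain ⟨p, hp, hpR, A', B', hcard, hW', hX'⟩ :=
    exists_prime_sdpp_of_addEquiv hWA hXA (m := fun _ : Fin L => m) (fun _ => hm1)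
      (AddEquiv.refl (Fin L → ZMod m))
  rw [Fin.prod_const] at hpR
  -- the number of pairs kept
  obtain ⟨n, hn₀, hnN, hpn, hnP⟩ := hm₀ m hm₀m L hL N hWcard p hpR
  refine ⟨n, hn₀, p, hp, A' ∘ Fin.castLE hnN, B' ∘ Fin.castLE hnN, ?_, ?_, hpn, ?_⟩
  · intro i
    exact hW' (Fin.castLE hnN i)
  · intro i j k a ha a' ha' b hb b' hb' h0
    exact Fin.castLE_injective hnN (hX' _ _ _ a ha a' ha' b hb b' hb' h0)
  · intro i
    have hci := hcard (Fin.castLE hnN i)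
    simp only [Function.comp_apply]
    rw [hci.1, hci.2]
    simp only [A, B, Fintype.card_piFinset]
    rw [← Finset.prod_mul_distrib]
    refine hnP.trans ?_
    rw [← Fin.prod_const]
    push_cast
    refine Finset.prod_le_prod (fun t _ => by positivity) fun t _ => ?_
    exact_mod_cast hcov _

/-- THE SKELETON THEOREM: the crux `PrimeTwoFamilies`, by name, from the registered stubs (its only sorries
are theirs: `stub_paleyGadgets`, `stub_paleyCapacity` (open, via `selfConverseGadgets_of_paley`), `stub_selfConverse`,
`stub_capBookkeeping`); slices `δ > 1` follow from the
slice `δ = 1` by monotonicity. -/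
theorem PrimeTwoFamilies_of : FourierTwoFamiliesModP.PrimeTwoFamilies := by
  have hC : CapacityGadgets := stub_selfConverse selfConverseGadgets_of_paley
  rw [primeTwoFamilies_iff]
  intro δ hδ
  by_cases h1 : δ ≤ 1
  · exact primeTwoFamiliesAt_of_capacity hC hδ h1
  · exact (primeTwoFamiliesAt_of_capacity hC one_pos le_rfl).mono (le_of_not_ge h1)

/-! ## Corollaries: the equivalences and the single-scale kill criterion (modulo the provable stubs) -/

/-- `CapacityGadgets ↔ PrimeTwoFamilies` (⇐ through `stub_gadgetsOfCrux` and `stub_selfConverse`). -/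
theorem capacityGadgets_iff : CapacityGadgets ↔ FourierTwoFamiliesModP.PrimeTwoFamilies := by
  refine ⟨fun hC => ?_, fun hT => stub_selfConverse (stub_gadgetsOfCrux hT)⟩
  rw [primeTwoFamilies_iff]
  intro δ hδ
  by_cases h1 : δ ≤ 1
  · exact primeTwoFamiliesAt_of_capacity hC hδ h1
  · exact (primeTwoFamiliesAt_of_capacity hC one_pos le_rfl).mono (le_of_not_ge h1)

/-- `SelfConverseGadgets ↔ PrimeTwoFamilies`: the L = 2 form is NOT strictly stronger than the crux. -/
theorem selfConverseGadgets_iff : SelfConverseGadgets ↔ FourierTwoFamiliesModP.PrimeTwoFamilies :=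
  ⟨fun h => capacityGadgets_iff.1 (stub_selfConverse h), fun hT => stub_gadgetsOfCrux hT⟩

/-- `PrimeTwoFamilies ↔` packing-tightness at every scale `γ ∈ (0,1)` (PaddingSketch, crux-plan
ladder-zone-frame-cap §A). -/
theorem primeTwoFamilies_iff_packingTight :
    FourierTwoFamiliesModP.PrimeTwoFamilies ↔ ∀ γ : ℝ, 0 < γ → γ < 1 → PackingTightAt γ :=
  ⟨fun hT _ hγ hγ1 => stub_packingTightOfCrux hT hγ hγ1,
   fun h => primeTwoFamilies_iff.2 (stub_cruxOfPackingTight h)⟩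

/-- **SINGLE-SCALE KILL CRITERION**: a power defect `c > 0` at ANY ONE scale `γ ∈ (0,1)` refutes the crux. -/
theorem primeTwoFamilies_false_of_singleScaleDefect {γ c : ℝ} (hγ : 0 < γ) (hγ1 : γ < 1) (hc : 0 < c)
    (h : SingleScaleDefect γ c) : ¬ FourierTwoFamiliesModP.PrimeTwoFamilies := by
  intro hT
  obtain ⟨p₀, hp₀⟩ := h
  obtain ⟨p, hp, hprime, n, A, B, hW, hX, hcov, hn⟩ :=
    stub_packingTightOfCrux hT hγ hγ1 (c / 2) (by linarith) (max p₀ 2)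
  have hle := hp₀ p hprime ((le_max_left _ _).trans hp) n A B hW hX hcov
  have hp2 : (2 : ℝ) ≤ p := by exact_mod_cast (le_max_right _ _).trans hp
  have hlt : (p : ℝ) ^ (1 - γ / 2 - c) < (p : ℝ) ^ (1 - γ / 2 - c / 2) :=
    Real.rpow_lt_rpow_of_exponent_lt (by linarith) (by linarith)
  linarith [hn.trans hle]

end Summit.MatrixMultiplication.MatrixMultiplication.Cruxes.PrimeTwoFamilies.CapacityLift
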